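import Summits.Ventures.YMGap.RobustBall.RobustStarDoorZd
import Summits.Ventures.YMGap.RobustBall.TorusRowsSU2Star
import HarnessLib

/-!
# Venture YMGap, track ROBUST-BALL (Y2) — crux Y2-X2-Zd, step 6: `SU(2)`, `d = 4` ROWS of the mass gap on the
# gauge-invariant `ℤ⁴` ball through the robust star door

HONEST FRAMING. WHAT THIS IS: a venture file (cell `pub-ymgap`, track Y2 ROBUST-BALL, seat ds-2): NUMERIC
ROWS (numerals, `norm_num`, five-term exponential majorants) of `massGapOnBallZdG_of_robustStar`
(`RobustStarDoorZd.lean`) on the tree's quarter modulus (`K = 1` on `β_W ≤ 2/3`). The certificates are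
VERBATIM those of the torus star rows `TorusRowsSU2Star.lean` (same hypotheses, same `(c, λ)`, `K = 20`), now
concluding the `ℤ⁴` MASS GAP (unique DLR state + Shen–Zhu–Zhu clustering, rb-p1's currency
`PerturbedMassGapAt`) uniformly on the GAUGE-INVARIANT tier-1 `ℤ⁴` ball `MemBallZdG (2ε) ε R` (any range `R`),
in 't Hooft units `β_W/4`:
`(β_W, ε) = (1/8, 37/250), (1/6, 14/125), (1/5, 87/1000), (1/4, 11/200), (3/10, 7/250), (1/3, 3/250)`.
For comparison, the landed `ℤ⁴` rows on rb-p1's ball `MemBallZd` (single-link / pair doors) are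
`(1/8, .130) (1/6, .062) (1/5, .022)` and nothing at `β_W ≥ 2/9`. WHAT THIS IS NOT: every radius is an artefact
of the door (it vanishes at the star's Wilson threshold `β_W ≈ 0.36`); strong-coupling LATTICE statements —
nothing about the continuum limit or the Millennium problem; tier 2 (infinite range) is not touched.

## References
* The tree: `RobustBall/RobustStarDoorZd.lean` (the door), `RobustBall/TorusRowsSU2Star.lean` (g7: the torus
  schema and certificates, followed line by line; `su2_quarterModulus`, `exp_le_*_star`), `TorusRowsSU2.lean`
  (`sqrt_two_le`).
-/

noncomputable section

open Literature.MathematicalPhysics.QuantumFieldTheory.Balaban1983to89.StrongCouplingDobrushinWindow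
  (OneLinkKRModulus)
open Summit.Ventures.YMGap.StarResolventDim (Delta gaugeR doorPoly gaugeR_lt_one_of_door)

namespace Summit.Ventures.YMGap.RobustBall

/-! ### The schema: `SU(2)`, `d = 4`, quarter modulus, robust star door on `ℤ⁴` -/

/-- **SCHEMA, `SU(2)`, `d = 4`: the mass gap on the whole gauge-invariant tier-1 `ℤ⁴` ball
`MemBallZdG ε₀ ε₁ R` at 't Hooft coupling `β_W/4` (tree coupling `β_W/2`, `0 < β_W ≤ 2/3`) through the ROBUST
STAR DOOR** on the quarter modulus: given decimal majorants `e^{ε₀} ≤ E`, `√2 ≤ S`, a coefficient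
`c ≥ E(1 + 2Sε₁)β_W/4`, `λ ≥ Sε₁`, and the three rational inequalities `doorPoly 4 c < 1`, `6c + λ < 1`,
`gaugeR 4 c + (λ + (6c+λ)^K·16λ)/(1 − (6c+λ)) < 1`: `MassGapOnBallZdG 4 2 (β_W/4) ε₀ ε₁ R`. [folklore] -/
theorem su2_massGapOnBallZdG_star (Kn : ℕ) {βW ε₀ ε₁ c lam E S : ℝ} (hβ0 : 0 ≤ βW) (hβ : βW ≤ 2 / 3)
    (hε₁ : 0 ≤ ε₁) (hE : Real.exp ε₀ ≤ E) (hS : Real.sqrt 2 ≤ S) (hc : E * (1 + 2 * S * ε₁) * (βW / 4) ≤ c)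
    (hlam : S * ε₁ ≤ lam) (hθ1 : 6 * c + lam < 1) (hcd : doorPoly 4 c < 1)
    (hρ1 : gaugeR 4 c + (lam + (6 * c + lam) ^ Kn * (16 * lam)) / (1 - (6 * c + lam)) < 1) (R : ℕ) :
    MassGapOnBallZdG 4 2 (βW / 4) ε₀ ε₁ R := by
  have hS0 : 0 ≤ S := (Real.sqrt_nonneg _).trans hS
  have hE0 : 0 ≤ E := (Real.exp_pos _).le.trans hE
  set θ : ℝ := 6 * c + lam with hθ
  set ρ : ℝ := gaugeR 4 c + (lam + θ ^ Kn * (16 * lam)) / (1 - θ) with hρ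
  have habs : |((2 : ℕ) : ℝ) * (βW / 4)| / ((2 : ℕ) : ℝ) = βW / 4 := by
    rw [abs_of_nonneg (by positivity)]
    push_cast
    ring
  have hR : |((2 : ℕ) : ℝ) * (βW / 4)| / ((2 : ℕ) : ℝ) * (2 * (((4 : ℕ) : ℝ) - 1)) ≤ 3 * βW / 2 := by
    rw [habs]; push_cast; linarith
  have hc' : (1 : ℝ) * Real.exp ε₀ * (1 + 2 * Real.sqrt ((2 : ℕ) : ℝ) * ε₁) *
      (|((2 : ℕ) : ℝ) * (βW / 4)| / ((2 : ℕ) : ℝ)) ≤ c := by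
    refine le_trans ?_ hc
    have h1 : Real.sqrt ((2 : ℕ) : ℝ) = Real.sqrt 2 := by norm_num
    rw [h1, one_mul, habs]
    have hb : 0 ≤ βW / 4 := by positivity
    calc Real.exp ε₀ * (1 + 2 * Real.sqrt 2 * ε₁) * (βW / 4) ≤ E * (1 + 2 * Real.sqrt 2 * ε₁) * (βW / 4) := by
          gcongr
      _ ≤ E * (1 + 2 * S * ε₁) * (βW / 4) := by gcongr
  have hlam' : Real.sqrt ((2 : ℕ) : ℝ) * ε₁ ≤ lam := by
    have h1 : Real.sqrt ((2 : ℕ) : ℝ) = Real.sqrt 2 := by norm_num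
    rw [h1]; exact le_trans (mul_le_mul_of_nonneg_right hS hε₁) hlam
  have hθ' : θ = (2 * ((4 : ℕ) : ℝ) - 2) * c + lam := by rw [hθ]; push_cast; ring
  have hρ' : ρ = gaugeR 4 c + (lam + θ ^ Kn * (4 * ((4 : ℕ) : ℝ) * lam)) / (1 - θ) := by rw [hρ]; push_cast; ring
  exact massGapOnBallZdG_of_robustStar (d := 4) (N := 2) (by norm_num) (by norm_num) zero_le_one hR
    (su2_quarterModulus hβ) hε₁ hc' hlam' hθ' hθ1 hcd hρ' hρ1

/-! ### The rows (ℤ⁴ mass gap on the whole gauge-invariant tier-1 ball, robust star door) -/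

/-- **ROW `(β_W, ε) = (1 / 8, 37 / 250)`, `SU(2)`, `d = 4`, ROBUST STAR DOOR ON `ℤ⁴`** — every member of the
gauge-invariant tier-1 `ℤ⁴` ball `MemBallZdG (37 / 125) (37 / 250) R` (any range `R`) has exactly one DLR state
and Shen–Zhu–Zhu exponential clustering at 't Hooft coupling `1 / 32` (certificate `c = 59603 / 1000000`,
`λ = 41861 / 200000`); HYPOTHESIS-FREE. [folklore] -/
theorem su2_massGapOnBallZdG_star_oneEighth (R : ℕ) : MassGapOnBallZdG 4 2 (1 / 32) (37 / 125) (37 / 250) R := by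
  have e1 : (1 / 8 : ℝ) / 4 = 1 / 32 := by norm_num
  have h := su2_massGapOnBallZdG_star 20 (βW := 1 / 8) (ε₀ := 37 / 125) (ε₁ := 37 / 250)
    (c := 59603 / 1000000) (lam := 41861 / 200000) (by norm_num) (by norm_num) (by norm_num) exp_le_37_125_star
    sqrt_two_le (by norm_num) (by norm_num) (by norm_num) (by unfold doorPoly; norm_num)
    (by unfold gaugeR Delta; norm_num) R
  rw [e1] at h
  exact h

/-- **ROW `(β_W, ε) = (1 / 6, 14 / 125)`, `SU(2)`, `d = 4`, ROBUST STAR DOOR ON `ℤ⁴`** — `MemBallZdG (28 / 125)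
(14 / 125) R`, 't Hooft coupling `1 / 24` (certificate `c = 34321 / 500000`, `λ = 158393 / 1000000`);
HYPOTHESIS-FREE. [folklore] -/
theorem su2_massGapOnBallZdG_star_oneSixth (R : ℕ) : MassGapOnBallZdG 4 2 (1 / 24) (28 / 125) (14 / 125) R := by
  have e1 : (1 / 6 : ℝ) / 4 = 1 / 24 := by norm_num
  have h := su2_massGapOnBallZdG_star 20 (βW := 1 / 6) (ε₀ := 28 / 125) (ε₁ := 14 / 125)
    (c := 34321 / 500000) (lam := 158393 / 1000000) (by norm_num) (by norm_num) (by norm_num) exp_le_28_125_star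
    sqrt_two_le (by norm_num) (by norm_num) (by norm_num) (by unfold doorPoly; norm_num)
    (by unfold gaugeR Delta; norm_num) R
  rw [e1] at h
  exact h

/-- **ROW `(β_W, ε) = (1 / 5, 87 / 1000)`, `SU(2)`, `d = 4`, ROBUST STAR DOOR ON `ℤ⁴`** — `MemBallZdG (87 / 500)
(87 / 1000) R`, 't Hooft coupling `1 / 20` (certificate `c = 14829 / 200000`, `λ = 61519 / 500000`);
HYPOTHESIS-FREE. [folklore] -/
theorem su2_massGapOnBallZdG_star_oneFifth (R : ℕ) : MassGapOnBallZdG 4 2 (1 / 20) (87 / 500) (87 / 1000) R := by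
  have e1 : (1 / 5 : ℝ) / 4 = 1 / 20 := by norm_num
  have h := su2_massGapOnBallZdG_star 20 (βW := 1 / 5) (ε₀ := 87 / 500) (ε₁ := 87 / 1000)
    (c := 14829 / 200000) (lam := 61519 / 500000) (by norm_num) (by norm_num) (by norm_num) exp_le_87_500_star
    sqrt_two_le (by norm_num) (by norm_num) (by norm_num) (by unfold doorPoly; norm_num)
    (by unfold gaugeR Delta; norm_num) R
  rw [e1] at h
  exact h

/-- **ROW `(β_W, ε) = (1 / 4, 11 / 200)`, `SU(2)`, `d = 4`, ROBUST STAR DOOR ON `ℤ⁴`** — `MemBallZdG (11 / 100)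
(11 / 200) R`, 't Hooft coupling `1 / 16` (certificate `c = 80621 / 1000000`, `λ = 77783 / 1000000`); beyond
the single-link threshold `β_W = 2/9`; HYPOTHESIS-FREE. [folklore] -/
theorem su2_massGapOnBallZdG_star_oneQuarter (R : ℕ) : MassGapOnBallZdG 4 2 (1 / 16) (11 / 100) (11 / 200) R := by
  have e1 : (1 / 4 : ℝ) / 4 = 1 / 16 := by norm_num
  have h := su2_massGapOnBallZdG_star 20 (βW := 1 / 4) (ε₀ := 11 / 100) (ε₁ := 11 / 200)
    (c := 80621 / 1000000) (lam := 77783 / 1000000) (by norm_num) (by norm_num) (by norm_num) exp_le_11_100_star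
    sqrt_two_le (by norm_num) (by norm_num) (by norm_num) (by unfold doorPoly; norm_num)
    (by unfold gaugeR Delta; norm_num) R
  rw [e1] at h
  exact h

/-- **ROW `(β_W, ε) = (3 / 10, 7 / 250)`, `SU(2)`, `d = 4`, ROBUST STAR DOOR ON `ℤ⁴`** — `MemBallZdG (7 / 125)
(7 / 250) R`, 't Hooft coupling `3 / 40` (certificate `c = 42801 / 500000`, `λ = 39599 / 1000000`);
HYPOTHESIS-FREE. [folklore] -/
theorem su2_massGapOnBallZdG_star_threeTenths (R : ℕ) : MassGapOnBallZdG 4 2 (3 / 40) (7 / 125) (7 / 250) R := by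
  have e1 : (3 / 10 : ℝ) / 4 = 3 / 40 := by norm_num
  have h := su2_massGapOnBallZdG_star 20 (βW := 3 / 10) (ε₀ := 7 / 125) (ε₁ := 7 / 250)
    (c := 42801 / 500000) (lam := 39599 / 1000000) (by norm_num) (by norm_num) (by norm_num) exp_le_7_125_star
    sqrt_two_le (by norm_num) (by norm_num) (by norm_num) (by unfold doorPoly; norm_num)
    (by unfold gaugeR Delta; norm_num) R
  rw [e1] at h
  exact h

/-- **ROW `(β_W, ε) = (1 / 3, 3 / 250)`, `SU(2)`, `d = 4`, ROBUST STAR DOOR ON `ℤ⁴`** — `MemBallZdG (3 / 125)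
(3 / 250) R`, 't Hooft coupling `1 / 12` (certificate `c = 17651 / 200000`, `λ = 16971 / 1000000`); the highest
`ℤ⁴` mass-gap coupling on a ball of actions in the tree; HYPOTHESIS-FREE. [folklore] -/
theorem su2_massGapOnBallZdG_star_oneThird (R : ℕ) : MassGapOnBallZdG 4 2 (1 / 12) (3 / 125) (3 / 250) R := by
  have e1 : (1 / 3 : ℝ) / 4 = 1 / 12 := by norm_num
  have h := su2_massGapOnBallZdG_star 20 (βW := 1 / 3) (ε₀ := 3 / 125) (ε₁ := 3 / 250)
    (c := 17651 / 200000) (lam := 16971 / 1000000) (by norm_num) (by norm_num) (by norm_num) exp_le_3_125_star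
    sqrt_two_le (by norm_num) (by norm_num) (by norm_num) (by unfold doorPoly; norm_num)
    (by unfold gaugeR Delta; norm_num) R
  rw [e1] at h
  exact h

/-- **UP TO `β_W = 1/3`**: the row of record holds at EVERY Wilson coupling `0 ≤ β_W ≤ 1/3` on the same ball
`MemBallZdG (3/125) (3/250) R` (the certificate is monotone in `β_W`). [folklore] -/
theorem su2_massGapOnBallZdG_star_upTo_oneThird {βW : ℝ} (h0 : 0 ≤ βW) (h : βW ≤ 1 / 3) (R : ℕ) :
    MassGapOnBallZdG 4 2 (βW / 4) (3 / 125) (3 / 250) R := by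
  refine su2_massGapOnBallZdG_star 20 (ε₀ := 3 / 125) (ε₁ := 3 / 250) (c := 17651 / 200000)
    (lam := 16971 / 1000000) (E := 1024291 / 1000000) (S := 1.41422) h0 (h.trans (by norm_num)) (by norm_num)
    exp_le_3_125_star sqrt_two_le ?_ (by norm_num) (by norm_num) (by unfold doorPoly; norm_num)
    (by unfold gaugeR Delta; norm_num) R
  calc (1024291 / 1000000 : ℝ) * (1 + 2 * 1.41422 * (3 / 250)) * (βW / 4)
      ≤ 1024291 / 1000000 * (1 + 2 * 1.41422 * (3 / 250)) * ((1 / 3) / 4) := by gcongr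
    _ ≤ 17651 / 200000 := by norm_num

/-- **The Wilson point as a corollary**: `MassGapAt 4 2 (1/12)` (`SU(2)`, `d = 4`, β_W = 1/3) from the row with
the zero member (consistency with the tree's `su2_massGapAt_le_9_100`, which reaches β_W = 9/25 at the centre).
[folklore] -/
theorem su2_massGapAt_oneThird_of_ball : MassGapAt 4 2 (1 / 12) :=
  (su2_massGapOnBallZdG_star_oneThird 0).massGapAt (by norm_num) (by norm_num)

end Summit.Ventures.YMGap.RobustBall

end
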